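import Mathlib
import HarnessLib

/-!
# ζ(5) search — Families: coefficient asymptotics of powers of a positive polynomial, IV — rational points are dense
# in the real solution space of an integer linear system

HONEST FRAMING: systematic search; no irrationality claim unless certified.  Cell `pub-zeta5`, certifier 2
(cert-2 g9, 2026-08-22).  Elementary linear algebra over `ℚ ⊂ ℝ`; no conjecture node is used; nothing about `ζ(5)`;
no number of record moves.

**`exists_rat_near_of_integer_system`** — if `x ∈ ℝ^ι` (`ι` finite) solves finitely many homogeneous linear
equations `Σ_i x_i v_i = 0` with INTEGER coefficient vectors `v`, then for every `ε > 0` there is a RATIONAL solution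
`q ∈ ℚ^ι` of the same equations with `|x_i − q_i| < ε` for all `i`.  (Induction on the number of equations: either the
new equation already holds at every rational solution of the previous ones, or some rational solution `q₀` violates it
and one corrects a nearby rational solution along `q₀`.)  This is the arithmetic input of the method of types in
`Families/CoeffAsympLower`: the tilted measure at the minimum of the tilt has mean exactly `B`, and nearby RATIONAL
measures with mean exactly `B` give integer types of exponent exactly `n • B`.
Standard axioms only.
-/

noncomputable section

open Finset Real

namespace Summit.KontsevichZagierPeriods.Zeta5Search.Families.Cellular

namespace CoeffAsymp

variable {ι : Type*} [Fintype ι]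

/-- The real linear form `y ↦ Σ_i y_i v_i` of an integer vector `v`, on rational points, is the cast of the rational
value. -/
theorem sum_cast_mul_cast (q : ι → ℚ) (v : ι → ℤ) :
    ∑ i, ((q i : ℚ) : ℝ) * (v i : ℝ) = ((∑ i, q i * (v i : ℚ) : ℚ) : ℝ) := by
  push_cast
  rfl

/-- **Rational solutions are dense in the real solutions of a homogeneous integer linear system.** -/
theorem exists_rat_near_of_integer_system (L : List (ι → ℤ)) :
    ∀ x : ι → ℝ, (∀ v ∈ L, ∑ i, x i * (v i : ℝ) = 0) → ∀ ε : ℝ, 0 < ε →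
      ∃ q : ι → ℚ, (∀ v ∈ L, ∑ i, ((q i : ℚ) : ℝ) * (v i : ℝ) = 0) ∧ ∀ i, |x i - (q i : ℝ)| < ε := by
  induction L with
  | nil =>
    intro x _ ε hε
    have h : ∀ i, ∃ q : ℚ, |x i - (q : ℝ)| < ε := by
      intro i
      obtain ⟨q, h1, h2⟩ := exists_rat_btwn (show x i - ε < x i + ε by linarith)
      exact ⟨q, by rw [abs_lt]; constructor <;> linarith⟩
    choose q hq using h
    exact ⟨q, fun v hv => by simp at hv, hq⟩
  | cons v L ih =>
    intro x hx ε hε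
    have hxL : ∀ w ∈ L, ∑ i, x i * (w i : ℝ) = 0 := fun w hw => hx w (List.mem_cons_of_mem v hw)
    have hxv : ∑ i, x i * (v i : ℝ) = 0 := hx v (by simp)
    by_cases hA : ∀ q : ι → ℚ, (∀ w ∈ L, ∑ i, ((q i : ℚ) : ℝ) * (w i : ℝ) = 0) →
        ∑ i, ((q i : ℚ) : ℝ) * (v i : ℝ) = 0
    · -- the new equation holds at every rational solution of the old ones
      obtain ⟨q, hqL, hqx⟩ := ih x hxL ε hε
      refine ⟨q, fun w hw => ?_, hqx⟩
      rcases List.mem_cons.1 hw with rfl | hw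
      · exact hA q hqL
      · exact hqL w hw
    · -- some rational solution `q₀` of the old equations violates the new one: correct along `q₀`
      obtain ⟨q₀, hq₀L, hq₀v⟩ : ∃ q₀ : ι → ℚ, (∀ w ∈ L, ∑ i, ((q₀ i : ℚ) : ℝ) * (w i : ℝ) = 0) ∧
          ∑ i, ((q₀ i : ℚ) : ℝ) * (v i : ℝ) ≠ 0 := by
        simpa [not_forall, exists_prop] using hA
      set f₀ : ℚ := ∑ i, q₀ i * (v i : ℚ) with hf₀
      have hf₀R : ∑ i, ((q₀ i : ℚ) : ℝ) * (v i : ℝ) = (f₀ : ℝ) := sum_cast_mul_cast q₀ v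
      have hf₀ne : (f₀ : ℝ) ≠ 0 := by rwa [← hf₀R]
      have hf₀pos : 0 < |(f₀ : ℝ)| := abs_pos.2 hf₀ne
      set C : ℝ := ∑ i, |(v i : ℝ)| with hC
      set M : ℝ := ∑ i, |((q₀ i : ℚ) : ℝ)| with hM
      have hC0 : 0 ≤ C := Finset.sum_nonneg fun i _ => abs_nonneg _
      have hM0 : 0 ≤ M := Finset.sum_nonneg fun i _ => abs_nonneg _
      set K : ℝ := 1 + C * M / |(f₀ : ℝ)| with hK
      have hK1 : 1 ≤ K := by
        have : 0 ≤ C * M / |(f₀ : ℝ)| := div_nonneg (mul_nonneg hC0 hM0) hf₀pos.le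
        linarith
      have hKpos : 0 < K := by linarith
      obtain ⟨r, hrL, hrx⟩ := ih x hxL (ε / K) (div_pos hε hKpos)
      -- the rational correction coefficient
      set t : ℚ := (∑ i, r i * (v i : ℚ)) / f₀ with ht
      have hfrR : ∑ i, ((r i : ℚ) : ℝ) * (v i : ℝ) = ((∑ i, r i * (v i : ℚ) : ℚ) : ℝ) := sum_cast_mul_cast r v
      have htR : (t : ℝ) = (∑ i, ((r i : ℚ) : ℝ) * (v i : ℝ)) / (f₀ : ℝ) := by
        rw [ht, hfrR]; push_cast; rfl
      -- `|f(r)| = |f(r) − f(x)| ≤ C · (ε / K)`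
      have hfr_bound : |∑ i, ((r i : ℚ) : ℝ) * (v i : ℝ)| ≤ C * (ε / K) := by
        have hdiff : ∑ i, ((r i : ℚ) : ℝ) * (v i : ℝ) = ∑ i, (((r i : ℚ) : ℝ) - x i) * (v i : ℝ) := by
          rw [← sub_zero (∑ i, ((r i : ℚ) : ℝ) * (v i : ℝ)), ← hxv, ← Finset.sum_sub_distrib]
          exact Finset.sum_congr rfl fun i _ => by ring
        rw [hdiff]
        calc |∑ i, (((r i : ℚ) : ℝ) - x i) * (v i : ℝ)| ≤ ∑ i, |(((r i : ℚ) : ℝ) - x i) * (v i : ℝ)| :=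
              Finset.abs_sum_le_sum_abs _ _
          _ ≤ ∑ i, (ε / K) * |(v i : ℝ)| := by
              refine Finset.sum_le_sum fun i _ => ?_
              rw [abs_mul]
              refine mul_le_mul_of_nonneg_right ?_ (abs_nonneg _)
              rw [abs_sub_comm]; exact (hrx i).le
          _ = C * (ε / K) := by rw [hC, Finset.sum_mul]; exact Finset.sum_congr rfl fun i _ => by ring
      have ht_bound : |(t : ℝ)| ≤ C * (ε / K) / |(f₀ : ℝ)| := by
        rw [htR, abs_div]
        exact div_le_div_of_nonneg_right hfr_bound hf₀pos.le
      refine ⟨fun i => r i - t * q₀ i, fun w hw => ?_, fun i => ?_⟩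
      · -- the equations
        have hsplit : ∑ i, (((r i - t * q₀ i : ℚ) : ℚ) : ℝ) * (w i : ℝ) =
            (∑ i, ((r i : ℚ) : ℝ) * (w i : ℝ)) - (t : ℝ) * ∑ i, ((q₀ i : ℚ) : ℝ) * (w i : ℝ) := by
          push_cast
          rw [Finset.mul_sum, ← Finset.sum_sub_distrib]
          exact Finset.sum_congr rfl fun i _ => by ring
        rw [hsplit]
        rcases List.mem_cons.1 hw with rfl | hw
        · rw [hf₀R, htR, div_mul_cancel₀ _ hf₀ne, sub_self]
        · rw [hrL w hw, hq₀L w hw, mul_zero, sub_zero]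
      · -- the distance
        have h1 : |x i - (((r i - t * q₀ i : ℚ) : ℚ) : ℝ)| ≤ |x i - (r i : ℝ)| + |(t : ℝ)| * |((q₀ i : ℚ) : ℝ)| := by
          push_cast
          calc |x i - ((r i : ℝ) - (t : ℝ) * (q₀ i : ℝ))| = |(x i - (r i : ℝ)) + (t : ℝ) * (q₀ i : ℝ)| := by ring_nf
            _ ≤ |x i - (r i : ℝ)| + |(t : ℝ) * (q₀ i : ℝ)| := abs_add_le _ _
            _ = |x i - (r i : ℝ)| + |(t : ℝ)| * |((q₀ i : ℚ) : ℝ)| := by rw [abs_mul]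
        have hqi : |((q₀ i : ℚ) : ℝ)| ≤ M := by
          rw [hM]
          exact Finset.single_le_sum (f := fun j => |((q₀ j : ℚ) : ℝ)|) (fun j _ => abs_nonneg _) (Finset.mem_univ i)
        have h2 : |(t : ℝ)| * |((q₀ i : ℚ) : ℝ)| ≤ C * (ε / K) / |(f₀ : ℝ)| * M :=
          mul_le_mul ht_bound hqi (abs_nonneg _) (div_nonneg (mul_nonneg hC0 (div_pos hε hKpos).le) hf₀pos.le)
        have h3 : ε / K + C * (ε / K) / |(f₀ : ℝ)| * M = ε := by
          rw [hK]
          field_simp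
        calc |x i - (((r i - t * q₀ i : ℚ) : ℚ) : ℝ)| ≤ |x i - (r i : ℝ)| + |(t : ℝ)| * |((q₀ i : ℚ) : ℝ)| := h1
          _ < ε / K + C * (ε / K) / |(f₀ : ℝ)| * M := add_lt_add_of_lt_of_le (hrx i) h2
          _ = ε := h3

end CoeffAsymp

end Summit.KontsevichZagierPeriods.Zeta5Search.Families.Cellular
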